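import Mathlib
import Literature.NumberTheory.LFunctions.Zhang2022.Section15CLemma153RpGlue
import Literature.NumberTheory.LFunctions.Zhang2022.Section15BStep15u035
import Literature.NumberTheory.LFunctions.Zhang2022.TypedSection15BEuler
import Literature.NumberTheory.Sieve.DivisorBound
import HarnessLib

/-!
# Zhang (2022), App. A p. 105 / §15 Lemma 15.3: the Euler product `𝒰₁ⱼ(s) = ∏_q 𝔲ᴿ₁ⱼ(q,s)` of the
# repaired `𝒰₁ⱼ` on `σ > 1` (`Typed.AppendixA2.StepA_u030R`) — PROVED

Topic `Literature/NumberTheory/LFunctions/Zhang2022` (Landau–Siegel audit tree; verdict-neutral).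
Y. Zhang, *Discrete mean estimates and the Landau–Siegel zero*, arXiv:2211.02515v1 (2022)
[Zhang2022LandauSiegel], §15 Lemma 15.3 p. 87 and its Appendix-A sketch p. 105 (tex L5174: "the Euler
product representation `𝔲_{1j}(s) = ∏_q 𝔲_{1j}(q,s)`"), **an unrefereed manuscript under adjudication;
nothing here asserts or denies its Theorems 1–2.** The node is typed, for the REPAIRED object of GAP
row G-L4t3-1 (normaliser `(ζ(s)²L(s−βⱼ,χ)²)⁻¹`, `Typed.Section15C.calU1R`, local factor
`Typed.AppendixA2.frakU1FactorR`), as `Typed.AppendixA2.StepA_u030R c′`: for `D` large, under (A),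
`1 ≤ j ≤ 3`, `σ > 1`: `calU1R(s) = ∏'_q 𝔲ᴿ₁ⱼ(q,s)`.

This file PROVES it (theorems only, no definitions, no facts), following the one-line argument of the
sketch ("`ϖ₁ⱼ` being multiplicative by (15.18) and `χ(n)τ₂(n)n^{−s}` multiplicative") with the absolute
convergence made explicit — the twin of `AppendixAEulerProductU004` (zl-w09-p4) / `TypedSection15BEuler`:

* §1 sizes: `‖λ₁(d)‖ ≤ 5^{ω(d)}` (`Section15BEuler.norm_lam1_prime_le`), and — GIVEN the two tree facts
  that hold for large `D` under (A): `‖𝓜₁(1,1;1−βⱼ)‖ ≥ 1/2` (`Section15B.norm_calM1_one_one_betaJ_ge`) and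
  u035 `‖𝓜₁(d,l;1−βⱼ)‖ ≤ C∏_{q∣dl}(1 + cq^{−9/10})` (`Section15B.step15_u035_holds`) —
  `‖ϖ₁ⱼ(n)‖ ≤ 2|C|·τ(n)·(5(1+|c|))^{ω(n)}`, hence `‖χ(n)τ₂(n)ϖ₁ⱼ(n)‖ ≤ 2|C|τ(n)^{2+log₂(5(1+|c|))}` and the
  Dirichlet series `Σ χ(n)τ₂(n)ϖ₁ⱼ(n)n^{−s}` converges absolutely for `σ > 1` (divisor bound
  `Sieve.exists_card_divisors_le_mul_rpow`);
* §2 the Euler product (Mathlib `EulerProduct.eulerProduct_hasProd`; multiplicativity of `ϖ₁ⱼ` from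
  `Section15B.inline15_varpiMult_holds`, of `τ₂` from `Nat.Coprime.card_divisors_mul`), whose local
  factor at `q` is the `r`-series of `frakU1FactorR` verbatim;
* §3 the prefactor `∏_q (1−q^{−s})²(1−χ(q)q^{−(s−βⱼ)})² = (ζ(s)²L(s−βⱼ,χ)²)⁻¹` (Mathlib Euler products of
  `ζ` and `L(·,χ)` at `s` and `s − βⱼ`, `Re(s−βⱼ) = σ > 1`), and the assembly
  `hasProd_frakU1FactorR_calU1R`;
* §4 **`Typed.AppendixA2.stepA_u030R_holds : StepA_u030R c′`** for every `c′`.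

With `Section15CLemma153RpGlue.lemma153RpI_of_local` this leaves, for leaf `h153RpI`, the local
holomorphy/estimate of `𝔲ᴿ₁ⱼ(q,·)` (row G-d52-1) and the value `Step15_u053R`.
WHAT THIS IS NOT: anything about Theorems 1–2 / Landau–Siegel zeros.

## References

* Y. Zhang, arXiv:2211.02515v1 (2022), App. A p. 105 (tex L5174); §15 pp. 85–87.
  [cite: Zhang2022LandauSiegel, App. A p. 105]
* G. H. Hardy, E. M. Wright, *An Introduction to the Theory of Numbers*, Thm 315 (divisor bound). [folklore]
-/

noncomputable section

open Complex Real Finset Filter Topology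

namespace Literature.NumberTheory.LFunctions.Zhang2022.Typed.Section15C

open Literature.NumberTheory.LFunctions.Zhang2022
open Literature.NumberTheory.LFunctions.Zhang2022.Skeleton
open Literature.NumberTheory.LFunctions.Zhang2022.Typed.Section15A
open Literature.NumberTheory.LFunctions.Zhang2022.Typed.Section15B
open Literature.NumberTheory.LFunctions.Zhang2022.Typed.AppendixA2

/-! ## §0. Folklore on `ω`, `τ` -/

section Folklore

/-- `2^{ω(n)} ≤ τ(n)` (`n ≥ 1`). [folklore] -/
private theorem two_pow_card_primeFactors_le_card_divisors {n : ℕ} (hn : n ≠ 0) :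
    2 ^ n.primeFactors.card ≤ n.divisors.card := by
  rw [Nat.card_divisors hn]
  refine Finset.pow_card_le_prod _ _ _ fun p hp => ?_
  have : 0 < n.factorization p := Nat.Prime.factorization_pos_of_dvd (Nat.prime_of_mem_primeFactors hp)
    hn (Nat.dvd_of_mem_primeFactors hp)
  omega

/-- `1 ≤ τ(n)` for `n ≥ 1`. [folklore] -/
private theorem one_le_card_divisors {n : ℕ} (hn : n ≠ 0) : 1 ≤ n.divisors.card :=
  Finset.card_pos.mpr ⟨1, Nat.one_mem_divisors.mpr hn⟩

/-- `A^{ω(n)} ≤ τ(n)^{log₂ A}` for `A ≥ 1`, `n ≥ 1`. [folklore] -/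
private theorem pow_card_primeFactors_le_rpow_card_divisors {A : ℝ} (hA : 1 ≤ A) {n : ℕ} (hn : n ≠ 0) :
    A ^ n.primeFactors.card ≤ (n.divisors.card : ℝ) ^ Real.logb 2 A := by
  have hA0 : 0 < A := one_pos.trans_le hA
  have ht : 0 ≤ Real.logb 2 A := Real.logb_nonneg one_lt_two hA
  have h2 : (2 : ℝ) ^ (n.primeFactors.card : ℝ) ≤ (n.divisors.card : ℝ) := by
    rw [Real.rpow_natCast]
    exact_mod_cast two_pow_card_primeFactors_le_card_divisors hn
  have hA2 : A = (2 : ℝ) ^ Real.logb 2 A := (Real.rpow_logb two_pos (by norm_num) hA0).symm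
  calc A ^ n.primeFactors.card = ((2 : ℝ) ^ Real.logb 2 A) ^ (n.primeFactors.card : ℝ) := by
        rw [Real.rpow_natCast, ← hA2]
    _ = ((2 : ℝ) ^ (n.primeFactors.card : ℝ)) ^ Real.logb 2 A := by
        rw [← Real.rpow_mul zero_le_two, mul_comm, Real.rpow_mul zero_le_two]
    _ ≤ (n.divisors.card : ℝ) ^ Real.logb 2 A :=
        Real.rpow_le_rpow (by positivity) h2 ht

/-- `#(divisorsAntidiagonal n) = τ(n)`. [folklore] -/
private theorem card_divisorsAntidiagonal_eq (n : ℕ) :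
    n.divisorsAntidiagonal.card = n.divisors.card := by
  rw [← Nat.map_div_right_divisors, Finset.card_map]

/-- `Re βⱼ = 0` (the shifts `β₁, β₂, β₃` of (2.13) are purely imaginary; as the tree's
`Section8PerronSteps.betaJ_re`). [cite: Zhang2022LandauSiegel, §2 (2.13)] -/
private theorem betaJ_re' (c' : ℝ) (D : ℕ) (j : ℕ) :
    (Literature.NumberTheory.LFunctions.Zhang2022.Skeleton.betaJ c' D j).re = 0 := by
  unfold Skeleton.betaJ Skeleton.beta1 Skeleton.beta2 Skeleton.beta3
  split_ifs <;> simp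

end Folklore

/-! ## §1. Sizes of `λ₁(d)` and `ϖ₁ⱼ(n)` -/

section Sizes

variable (c' : ℝ) {D : ℕ} (χ : DirichletCharacter ℂ D)

/-- **`‖λ₁(d)‖ ≤ 5^{ω(d)}`** (`λ₁(d) = ∏_{q∣d} λ₁(q)`, `‖λ₁(q)‖ ≤ 5`). [cite: Zhang2022LandauSiegel, §15 (15.10) p. 82] -/
theorem norm_lam1_one_le_pow (d : ℕ) : ‖lam1 c' χ d 1‖ ≤ (5 : ℝ) ^ d.primeFactors.card := by
  rw [lam1_eq_prod_primeFactors c' χ d 1, norm_prod]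
  calc ∏ q ∈ d.primeFactors, ‖lam1 c' χ q 1‖ ≤ ∏ q ∈ d.primeFactors, (5 : ℝ) :=
        Finset.prod_le_prod (fun _ _ => norm_nonneg _) fun q hq =>
          Section15BEuler.norm_lam1_prime_le c' χ q (Nat.prime_of_mem_primeFactors hq)
    _ = 5 ^ d.primeFactors.card := Finset.prod_const _

/-- `∏_{q∣n}(1 + c q^{−9/10}) ≤ (1 + |c|)^{ω(n)}`. [folklore] -/
private theorem prod_one_add_mul_rpow_le (c : ℝ) (n : ℕ) :
    ∏ q ∈ n.primeFactors, (1 + c * (q : ℝ) ^ (-(9 / 10 : ℝ))) ≤ (1 + |c|) ^ n.primeFactors.card := by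
  calc ∏ q ∈ n.primeFactors, (1 + c * (q : ℝ) ^ (-(9 / 10 : ℝ)))
      ≤ |∏ q ∈ n.primeFactors, (1 + c * (q : ℝ) ^ (-(9 / 10 : ℝ)))| := le_abs_self _
    _ = ∏ q ∈ n.primeFactors, |1 + c * (q : ℝ) ^ (-(9 / 10 : ℝ))| := Finset.abs_prod _ _
    _ ≤ ∏ q ∈ n.primeFactors, (1 + |c|) := by
        refine Finset.prod_le_prod (fun _ _ => abs_nonneg _) fun q hq => ?_
        have hq1 : (1 : ℝ) ≤ q := by exact_mod_cast (Nat.prime_of_mem_primeFactors hq).one_lt.le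
        have hx0 : 0 ≤ (q : ℝ) ^ (-(9 / 10 : ℝ)) := Real.rpow_nonneg (by linarith) _
        have hx1 : (q : ℝ) ^ (-(9 / 10 : ℝ)) ≤ 1 := Real.rpow_le_one_of_one_le_of_nonpos hq1 (by norm_num)
        calc |1 + c * (q : ℝ) ^ (-(9 / 10 : ℝ))| ≤ |(1 : ℝ)| + |c * (q : ℝ) ^ (-(9 / 10 : ℝ))| :=
              abs_add_le _ _
          _ = 1 + |c| * (q : ℝ) ^ (-(9 / 10 : ℝ)) := by rw [abs_one, abs_mul, abs_of_nonneg hx0]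
          _ ≤ 1 + |c| * 1 := by gcongr
          _ = 1 + |c| := by ring
    _ = (1 + |c|) ^ n.primeFactors.card := Finset.prod_const _

/-- **`‖ϖ₁ⱼ(n)‖ ≤ 2|C|·τ(n)·(5(1+|c|))^{ω(n)}`** (`n ≥ 1`), given `‖𝓜₁(1,1;1−βⱼ)‖ ≥ 1/2` and
`‖𝓜₁(d,l;1−βⱼ)‖ ≤ C∏_{q∣dl}(1 + cq^{−9/10})` for `d, l ≥ 1` (u035 at `s = 1 − βⱼ`): each of the `τ(n)`
terms `λ₁(d)d^{βⱼ}χ(l)𝓜₁(d,l)/𝓜₁(1,1)` of `ϖ₁ⱼ(n)` has norm `≤ 5^{ω(n)}·2|C|(1+|c|)^{ω(n)}`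
(`|d^{βⱼ}| = 1`, `|χ| ≤ 1`). [cite: Zhang2022LandauSiegel, §15 p. 85] -/
theorem norm_varpi1_le (j : ℕ) {c C : ℝ}
    (hM0 : 1 / 2 ≤ ‖calM1 c' χ 1 1 (1 - betaJ c' D j)‖)
    (h35 : ∀ d l : ℕ, 1 ≤ d → 1 ≤ l →
      ‖calM1 c' χ d l (1 - betaJ c' D j)‖ ≤
        C * ∏ q ∈ (d * l).primeFactors, (1 + c * (q : ℝ) ^ (-(9 / 10 : ℝ))))
    {n : ℕ} (hn : n ≠ 0) :
    ‖varpi1 c' χ j n‖ ≤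
      2 * |C| * (n.divisors.card : ℝ) * (5 * (1 + |c|)) ^ n.primeFactors.card := by
  set M0 : ℂ := calM1 c' χ 1 1 (1 - betaJ c' D j) with hM0def
  have hM0pos : 0 < ‖M0‖ := lt_of_lt_of_le (by norm_num) hM0
  set K : ℝ := (5 : ℝ) ^ n.primeFactors.card * (2 * |C| * (1 + |c|) ^ n.primeFactors.card) with hKdef
  have hterm : ∀ x ∈ n.divisorsAntidiagonal,
      ‖lam1 c' χ x.1 1 * (x.1 : ℂ) ^ betaJ c' D j * χ (x.2 : ZMod D) *
          (calM1 c' χ x.1 x.2 (1 - betaJ c' D j) / M0)‖ ≤ K := by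
    intro x hx
    obtain ⟨hdl, -⟩ := Nat.mem_divisorsAntidiagonal.mp hx
    have hd0 : x.1 ≠ 0 := fun h0 => hn (by rw [← hdl, h0, zero_mul])
    have hl0 : x.2 ≠ 0 := fun h0 => hn (by rw [← hdl, h0, mul_zero])
    have hd1 : 1 ≤ x.1 := Nat.one_le_iff_ne_zero.mpr hd0
    have hl1 : 1 ≤ x.2 := Nat.one_le_iff_ne_zero.mpr hl0
    -- the four factors
    have h1 : ‖lam1 c' χ x.1 1‖ ≤ (5 : ℝ) ^ n.primeFactors.card := by
      refine (norm_lam1_one_le_pow c' χ x.1).trans (pow_le_pow_right₀ (by norm_num) ?_)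
      exact Finset.card_le_card (Nat.primeFactors_mono ⟨x.2, hdl.symm⟩ hn)
    have h2 : ‖(x.1 : ℂ) ^ betaJ c' D j‖ = 1 := by
      rw [Complex.norm_natCast_cpow_of_pos (Nat.pos_of_ne_zero hd0), betaJ_re',
        Real.rpow_zero]
    have h3 : ‖χ (x.2 : ZMod D)‖ ≤ 1 := χ.norm_le_one _
    have h4 : ‖calM1 c' χ x.1 x.2 (1 - betaJ c' D j) / M0‖ ≤ 2 * |C| * (1 + |c|) ^ n.primeFactors.card := by
      rw [norm_div, div_le_iff₀ hM0pos]
      have hnum : ‖calM1 c' χ x.1 x.2 (1 - betaJ c' D j)‖ ≤ |C| * (1 + |c|) ^ n.primeFactors.card := by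
        have h := h35 x.1 x.2 hd1 hl1
        rw [hdl] at h
        calc ‖calM1 c' χ x.1 x.2 (1 - betaJ c' D j)‖
            ≤ C * ∏ q ∈ n.primeFactors, (1 + c * (q : ℝ) ^ (-(9 / 10 : ℝ))) := h
          _ ≤ |C * ∏ q ∈ n.primeFactors, (1 + c * (q : ℝ) ^ (-(9 / 10 : ℝ)))| := le_abs_self _
          _ = |C| * |∏ q ∈ n.primeFactors, (1 + c * (q : ℝ) ^ (-(9 / 10 : ℝ)))| := abs_mul _ _
          _ ≤ |C| * (1 + |c|) ^ n.primeFactors.card := by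
              refine mul_le_mul_of_nonneg_left ?_ (abs_nonneg _)
              rw [Finset.abs_prod]
              calc ∏ q ∈ n.primeFactors, |1 + c * (q : ℝ) ^ (-(9 / 10 : ℝ))|
                  ≤ ∏ q ∈ n.primeFactors, (1 + |c|) := by
                    refine Finset.prod_le_prod (fun _ _ => abs_nonneg _) fun q hq => ?_
                    have hq1 : (1 : ℝ) ≤ q := by
                      exact_mod_cast (Nat.prime_of_mem_primeFactors hq).one_lt.le
                    have hx0 : 0 ≤ (q : ℝ) ^ (-(9 / 10 : ℝ)) := Real.rpow_nonneg (by linarith) _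
                    have hx1 : (q : ℝ) ^ (-(9 / 10 : ℝ)) ≤ 1 :=
                      Real.rpow_le_one_of_one_le_of_nonpos hq1 (by norm_num)
                    calc |1 + c * (q : ℝ) ^ (-(9 / 10 : ℝ))|
                        ≤ |(1 : ℝ)| + |c * (q : ℝ) ^ (-(9 / 10 : ℝ))| := abs_add_le _ _
                      _ = 1 + |c| * (q : ℝ) ^ (-(9 / 10 : ℝ)) := by
                          rw [abs_one, abs_mul, abs_of_nonneg hx0]
                      _ ≤ 1 + |c| * 1 := by gcongr
                      _ = 1 + |c| := by ring
                _ = (1 + |c|) ^ n.primeFactors.card := Finset.prod_const _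
      calc ‖calM1 c' χ x.1 x.2 (1 - betaJ c' D j)‖ ≤ |C| * (1 + |c|) ^ n.primeFactors.card := hnum
        _ = 2 * |C| * (1 + |c|) ^ n.primeFactors.card * (1 / 2) := by ring
        _ ≤ 2 * |C| * (1 + |c|) ^ n.primeFactors.card * ‖M0‖ := by
            gcongr
    rw [norm_mul, norm_mul, norm_mul, h2, mul_one, hKdef]
    have h13 : ‖lam1 c' χ x.1 1‖ * ‖χ (x.2 : ZMod D)‖ ≤ (5 : ℝ) ^ n.primeFactors.card * 1 :=
      mul_le_mul h1 h3 (norm_nonneg _) (by positivity)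
    calc ‖lam1 c' χ x.1 1‖ * ‖χ (x.2 : ZMod D)‖ * ‖calM1 c' χ x.1 x.2 (1 - betaJ c' D j) / M0‖
        ≤ ((5 : ℝ) ^ n.primeFactors.card * 1) * (2 * |C| * (1 + |c|) ^ n.primeFactors.card) :=
          mul_le_mul h13 h4 (norm_nonneg _) (by positivity)
      _ = (5 : ℝ) ^ n.primeFactors.card * (2 * |C| * (1 + |c|) ^ n.primeFactors.card) := by ring
  unfold varpi1
  calc ‖∑ x ∈ n.divisorsAntidiagonal, lam1 c' χ x.1 1 * (x.1 : ℂ) ^ betaJ c' D j * χ (x.2 : ZMod D) *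
          (calM1 c' χ x.1 x.2 (1 - betaJ c' D j) / calM1 c' χ 1 1 (1 - betaJ c' D j))‖
      ≤ ∑ x ∈ n.divisorsAntidiagonal, ‖lam1 c' χ x.1 1 * (x.1 : ℂ) ^ betaJ c' D j * χ (x.2 : ZMod D) *
          (calM1 c' χ x.1 x.2 (1 - betaJ c' D j) / calM1 c' χ 1 1 (1 - betaJ c' D j))‖ :=
        norm_sum_le _ _
    _ ≤ ∑ x ∈ n.divisorsAntidiagonal, K := Finset.sum_le_sum hterm
    _ = n.divisors.card * K := by rw [Finset.sum_const, nsmul_eq_mul, card_divisorsAntidiagonal_eq]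
    _ = 2 * |C| * (n.divisors.card : ℝ) * (5 * (1 + |c|)) ^ n.primeFactors.card := by
        rw [hKdef, mul_pow]; ring

/-- **`‖χ(n)τ₂(n)ϖ₁ⱼ(n)‖ ≤ 2|C|·τ(n)^{2 + log₂(5(1+|c|))}`** (`n ≥ 1`; `A^{ω(n)} ≤ τ(n)^{log₂ A}`).
[cite: Zhang2022LandauSiegel, §15 Lemma 15.3 p. 87] -/
theorem norm_chi_tau_varpi1_le (j : ℕ) {c C : ℝ}
    (hM0 : 1 / 2 ≤ ‖calM1 c' χ 1 1 (1 - betaJ c' D j)‖)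
    (h35 : ∀ d l : ℕ, 1 ≤ d → 1 ≤ l →
      ‖calM1 c' χ d l (1 - betaJ c' D j)‖ ≤
        C * ∏ q ∈ (d * l).primeFactors, (1 + c * (q : ℝ) ^ (-(9 / 10 : ℝ))))
    {n : ℕ} (hn : n ≠ 0) :
    ‖χ (n : ZMod D) * (n.divisors.card : ℂ) * varpi1 c' χ j n‖ ≤
      2 * |C| * (n.divisors.card : ℝ) ^ ((2 : ℝ) + Real.logb 2 (5 * (1 + |c|))) := by
  set A : ℝ := 5 * (1 + |c|) with hAdef
  have hA1 : 1 ≤ A := by rw [hAdef]; nlinarith [abs_nonneg c]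
  have hτ1 : (1 : ℝ) ≤ n.divisors.card := by exact_mod_cast one_le_card_divisors hn
  have hτ0 : (0 : ℝ) < n.divisors.card := one_pos.trans_le hτ1
  have hχ : ‖χ (n : ZMod D)‖ ≤ 1 := χ.norm_le_one _
  have hτn : ‖(n.divisors.card : ℂ)‖ = n.divisors.card := by
    rw [Complex.norm_natCast]
  have h1 := norm_varpi1_le c' χ j hM0 h35 hn
  have h2 : A ^ n.primeFactors.card ≤ (n.divisors.card : ℝ) ^ Real.logb 2 A :=
    pow_card_primeFactors_le_rpow_card_divisors hA1 hn
  rw [norm_mul, norm_mul, hτn]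
  calc ‖χ (n : ZMod D)‖ * (n.divisors.card : ℝ) * ‖varpi1 c' χ j n‖
      ≤ 1 * (n.divisors.card : ℝ) *
          (2 * |C| * (n.divisors.card : ℝ) * A ^ n.primeFactors.card) := by
        gcongr
    _ ≤ 1 * (n.divisors.card : ℝ) *
          (2 * |C| * (n.divisors.card : ℝ) * (n.divisors.card : ℝ) ^ Real.logb 2 A) := by
        gcongr
    _ = 2 * |C| * ((n.divisors.card : ℝ) ^ (2 : ℕ) * (n.divisors.card : ℝ) ^ Real.logb 2 A) := by ring
    _ = 2 * |C| * (n.divisors.card : ℝ) ^ ((2 : ℝ) + Real.logb 2 A) := by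
        rw [Real.rpow_add hτ0]
        congr 2
        exact_mod_cast (Real.rpow_natCast (n.divisors.card : ℝ) 2).symm

/-- **Absolute convergence of `Σ_n χ(n)τ₂(n)ϖ₁ⱼ(n)n^{−s}` for `σ > 1`** (given the two size facts):
with `t = 2 + log₂(5(1+|c|))`, `δ = (σ−1)/2` and the divisor bound `τ(n) ≤ C₀n^{δ/t}` the terms are
`≤ 2|C|C₀ᵗ n^{δ−σ}`. [cite: Zhang2022LandauSiegel, §15 Lemma 15.3 p. 87] -/
theorem lseriesSummable_chi_tau_varpi1 (j : ℕ) {c C : ℝ}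
    (hM0 : 1 / 2 ≤ ‖calM1 c' χ 1 1 (1 - betaJ c' D j)‖)
    (h35 : ∀ d l : ℕ, 1 ≤ d → 1 ≤ l →
      ‖calM1 c' χ d l (1 - betaJ c' D j)‖ ≤
        C * ∏ q ∈ (d * l).primeFactors, (1 + c * (q : ℝ) ^ (-(9 / 10 : ℝ))))
    {s : ℂ} (hs : 1 < s.re) :
    LSeriesSummable (fun n => χ (n : ZMod D) * (n.divisors.card : ℂ) * varpi1 c' χ j n) s := by
  set t : ℝ := (2 : ℝ) + Real.logb 2 (5 * (1 + |c|)) with ht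
  have hA1 : (1 : ℝ) ≤ 5 * (1 + |c|) := by nlinarith [abs_nonneg c]
  have hlogb : 0 ≤ Real.logb 2 (5 * (1 + |c|)) := Real.logb_nonneg one_lt_two hA1
  have ht0 : 0 < t := by rw [ht]; linarith
  set δ : ℝ := (s.re - 1) / 2 with hδ
  have hδ0 : 0 < δ := by rw [hδ]; linarith
  obtain ⟨C₀, hC1, hC⟩ := Literature.NumberTheory.Sieve.exists_card_divisors_le_mul_rpow
    (show 0 < δ / t by positivity)
  have hC0 : 0 ≤ C₀ := zero_le_one.trans hC1
  have hexp : δ - s.re < -1 := by rw [hδ]; linarith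
  have hmaj : Summable fun n : ℕ => 2 * |C| * C₀ ^ t * (n : ℝ) ^ (δ - s.re) :=
    (Real.summable_nat_rpow.mpr hexp).mul_left _
  refine Summable.of_norm_bounded hmaj fun n => ?_
  rcases eq_or_ne n 0 with rfl | hn
  · simp only [LSeries.term_zero, norm_zero, Nat.cast_zero]
    exact mul_nonneg (by positivity) (Real.rpow_nonneg le_rfl _)
  have hnR : (0 : ℝ) < n := by exact_mod_cast Nat.pos_of_ne_zero hn
  have hτ0 : (0 : ℝ) ≤ n.divisors.card := Nat.cast_nonneg _
  rw [LSeries.term_of_ne_zero hn, norm_div, Complex.norm_natCast_cpow_of_pos (Nat.pos_of_ne_zero hn),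
    div_le_iff₀ (Real.rpow_pos_of_pos hnR _)]
  have hτ : (n.divisors.card : ℝ) ≤ C₀ * (n : ℝ) ^ (δ / t) := hC n hn
  have hτt : (n.divisors.card : ℝ) ^ t ≤ (C₀ * (n : ℝ) ^ (δ / t)) ^ t :=
    Real.rpow_le_rpow hτ0 hτ ht0.le
  calc ‖χ (n : ZMod D) * (n.divisors.card : ℂ) * varpi1 c' χ j n‖
      ≤ 2 * |C| * (n.divisors.card : ℝ) ^ t := norm_chi_tau_varpi1_le c' χ j hM0 h35 hn
    _ ≤ 2 * |C| * (C₀ * (n : ℝ) ^ (δ / t)) ^ t := by gcongr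
    _ = 2 * |C| * (C₀ ^ t * (n : ℝ) ^ δ) := by
        rw [Real.mul_rpow hC0 (Real.rpow_nonneg hnR.le _), ← Real.rpow_mul hnR.le,
          div_mul_cancel₀ δ ht0.ne']
    _ = 2 * |C| * C₀ ^ t * (n : ℝ) ^ (δ - s.re) * (n : ℝ) ^ s.re := by
        rw [mul_assoc (2 * |C| * C₀ ^ t), ← Real.rpow_add hnR]
        ring_nf

end Sizes

/-! ## §2. The Euler product of `Σ_n χ(n)τ₂(n)ϖ₁ⱼ(n)n^{−s}` and its local factor -/

section Euler

open scoped LSeries.notation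
open LSeries (term)

variable (c' : ℝ) {D : ℕ} (χ : DirichletCharacter ℂ D) (j : ℕ)

/-- `(q^e)^s = (q^s)^e` for naturals `q, e` and complex `s`. [folklore] -/
private theorem natCast_pow_cpow (q e : ℕ) (s : ℂ) : ((q ^ e : ℕ) : ℂ) ^ s = ((q : ℂ) ^ s) ^ e := by
  induction e with
  | zero => simp
  | succ e ih => rw [pow_succ, Nat.cast_mul, Complex.natCast_mul_natCast_cpow, ih, pow_succ]

/-- The `L`-series term of `χτ₂ϖ₁ⱼ` at `1` is `1` when `ϖ₁ⱼ(1) = 1`.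
[cite: Zhang2022LandauSiegel, §15 p. 85] -/
private theorem termG_one (hv1 : varpi1 c' χ j 1 = 1) (s : ℂ) :
    term (fun n => χ (n : ZMod D) * (n.divisors.card : ℂ) * varpi1 c' χ j n) s 1 = 1 := by
  rw [LSeries.term_of_ne_zero one_ne_zero, hv1, Nat.divisors_one, Finset.card_singleton,
    Nat.cast_one, Nat.cast_one, map_one, Complex.one_cpow]
  norm_num

/-- The `L`-series terms of `χτ₂ϖ₁ⱼ` are multiplicative on coprime arguments when `ϖ₁ⱼ` is.
[cite: Zhang2022LandauSiegel, §15 p. 85] -/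
private theorem termG_mul_of_coprime
    (hvmul : ∀ m n : ℕ, Nat.Coprime m n → varpi1 c' χ j (m * n) = varpi1 c' χ j m * varpi1 c' χ j n)
    (s : ℂ) {m n : ℕ} (hmn : Nat.Coprime m n) :
    term (fun k => χ (k : ZMod D) * (k.divisors.card : ℂ) * varpi1 c' χ j k) s (m * n) =
      term (fun k => χ (k : ZMod D) * (k.divisors.card : ℂ) * varpi1 c' χ j k) s m *
        term (fun k => χ (k : ZMod D) * (k.divisors.card : ℂ) * varpi1 c' χ j k) s n := by
  rcases eq_or_ne m 0 with rfl | hm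
  · simp
  rcases eq_or_ne n 0 with rfl | hn
  · simp
  rw [LSeries.term_of_ne_zero (mul_ne_zero hm hn), LSeries.term_of_ne_zero hm,
    LSeries.term_of_ne_zero hn, hvmul m n hmn, Nat.Coprime.card_divisors_mul hmn,
    Nat.cast_mul, Nat.cast_mul, Nat.cast_mul, map_mul, Complex.natCast_mul_natCast_cpow,
    div_mul_div_comm]
  ring

/-- **Euler product of `Σ_n χ(n)τ₂(n)ϖ₁ⱼ(n)n^{−s}`** (`σ > 1`), given `ϖ₁ⱼ(1) = 1`, multiplicativity of
`ϖ₁ⱼ`, and the two size facts: `HasProd (q ↦ Σ_e χ(q^e)τ₂(q^e)ϖ₁ⱼ(q^e)q^{−es}) (Σ_n χ(n)τ₂(n)ϖ₁ⱼ(n)n^{−s})`.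
[cite: Zhang2022LandauSiegel, App. A p. 105] -/
theorem hasProd_chi_tau_varpi1 {c C : ℝ} (hv1 : varpi1 c' χ j 1 = 1)
    (hvmul : ∀ m n : ℕ, Nat.Coprime m n → varpi1 c' χ j (m * n) = varpi1 c' χ j m * varpi1 c' χ j n)
    (hM0 : 1 / 2 ≤ ‖calM1 c' χ 1 1 (1 - betaJ c' D j)‖)
    (h35 : ∀ d l : ℕ, 1 ≤ d → 1 ≤ l →
      ‖calM1 c' χ d l (1 - betaJ c' D j)‖ ≤
        C * ∏ q ∈ (d * l).primeFactors, (1 + c * (q : ℝ) ^ (-(9 / 10 : ℝ))))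
    {s : ℂ} (hs : 1 < s.re) :
    HasProd (fun q : Nat.Primes =>
        ∑' e : ℕ, term (fun n => χ (n : ZMod D) * (n.divisors.card : ℂ) * varpi1 c' χ j n) s (q ^ e))
      (∑' n : ℕ, term (fun n => χ (n : ZMod D) * (n.divisors.card : ℂ) * varpi1 c' χ j n) s n) :=
  EulerProduct.eulerProduct_hasProd (termG_one c' χ j hv1 s)
    (fun hmn => termG_mul_of_coprime c' χ j hvmul s hmn)
    (lseriesSummable_chi_tau_varpi1 c' χ j hM0 h35 hs).norm (LSeries.term_zero _ _)

/-- **The local factor** is the `r`-series of `frakU1FactorR` verbatim: for a prime `q`,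
`Σ_e term(q^e) = Σ_r χ(q^r)τ₂(q^r)ϖ₁ⱼ(q^r)/q^{rs}`. [cite: Zhang2022LandauSiegel, App. A p. 105] -/
theorem tsum_termG_prime_pow (s : ℂ) {q : ℕ} (hq : q.Prime) :
    ∑' e : ℕ, term (fun n => χ (n : ZMod D) * (n.divisors.card : ℂ) * varpi1 c' χ j n) s (q ^ e) =
      ∑' r : ℕ, χ ((q ^ r : ℕ) : ZMod D) * (((q ^ r).divisors.card : ℕ) : ℂ) *
        varpi1 c' χ j (q ^ r) / (q : ℂ) ^ ((r : ℂ) * s) := by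
  refine tsum_congr fun r => ?_
  rw [LSeries.term_of_ne_zero (pow_ne_zero _ hq.ne_zero), natCast_pow_cpow, Complex.cpow_nat_mul]

end Euler

/-! ## §3. The prefactor and the assembly -/

section Assembly

open scoped LSeries.notation
open LSeries (term)

variable (c' : ℝ) {D : ℕ} [NeZero D] (χ : DirichletCharacter ℂ D) (j : ℕ)

/-- An Euler product with nonvanishing value may be inverted factorwise: `∏' f = a ≠ 0` ⇒
`∏' f⁻¹ = a⁻¹` (in `ℂ`). [folklore] -/
private theorem hasProd_inv_of_ne_zero {ι : Type*} {f : ι → ℂ} {a : ℂ} (hf : HasProd f a)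
    (ha : a ≠ 0) : HasProd (fun i => (f i)⁻¹) a⁻¹ := by
  classical
  have hT : Tendsto (fun A : Finset ι => ∏ i ∈ A, f i) atTop (𝓝 a) := hf
  have hT' := hT.inv₀ ha
  have hfun : (fun A : Finset ι => ∏ i ∈ A, (f i)⁻¹) = fun A => (∏ i ∈ A, f i)⁻¹ := by
    funext A; rw [Finset.prod_inv_distrib]
  show Tendsto (fun A : Finset ι => ∏ i ∈ A, (f i)⁻¹) atTop (𝓝 a⁻¹)
  rw [hfun]; exact hT'

omit [NeZero D] in
/-- `Re(s − βⱼ) = Re s` (`βⱼ` is purely imaginary). [cite: Zhang2022LandauSiegel, §2 (2.13)] -/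
private theorem re_sub_betaJ (s : ℂ) : (s - betaJ c' D j).re = s.re := by
  rw [Complex.sub_re, betaJ_re', sub_zero]

/-- **The prefactor product**: for `σ > 1`,
`∏_q (1−q^{−s})²(1−χ(q)q^{−(s−βⱼ)})² = (ζ(s)²L(s−βⱼ,χ)²)⁻¹` (Euler products of `ζ` and `L(·,χ)`,
nonvanishing for `σ > 1`; `Re(s−βⱼ) = σ`). [cite: Zhang2022LandauSiegel, App. A p. 105] -/
theorem hasProd_prefR {s : ℂ} (hs : 1 < s.re) :
    HasProd (fun q : Nat.Primes =>
        (1 - ((q : ℕ) : ℂ) ^ (-s)) ^ 2 * (1 - χ ((q : ℕ) : ZMod D) * ((q : ℕ) : ℂ) ^ (-(s - betaJ c' D j))) ^ 2)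
      (riemannZeta s ^ 2 * χ.LFunction (s - betaJ c' D j) ^ 2)⁻¹ := by
  set s' : ℂ := s - betaJ c' D j with hs'
  have hs1 : 1 < s'.re := by rw [hs', re_sub_betaJ]; exact hs
  have hζne : riemannZeta s ≠ 0 := riemannZeta_ne_zero_of_one_lt_re hs
  have hLne : L ↗χ s' ≠ 0 := DirichletCharacter.LSeries_ne_zero_of_one_lt_re χ hs1
  have hZ : HasProd (fun p : Nat.Primes => 1 - (p : ℂ) ^ (-s)) (riemannZeta s)⁻¹ := by
    have h := hasProd_inv_of_ne_zero (riemannZeta_eulerProduct_hasProd hs) hζne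
    simpa only [inv_inv] using h
  have hL : HasProd (fun p : Nat.Primes => 1 - χ ((p : ℕ) : ZMod D) * (p : ℂ) ^ (-s')) (L ↗χ s')⁻¹ := by
    have h := hasProd_inv_of_ne_zero (DirichletCharacter.LSeries_eulerProduct_hasProd χ hs1) hLne
    simpa only [inv_inv] using h
  have h := (hZ.mul hZ).mul (hL.mul hL)
  have hfun : (fun q : Nat.Primes =>
      (1 - ((q : ℕ) : ℂ) ^ (-s)) ^ 2 * (1 - χ ((q : ℕ) : ZMod D) * ((q : ℕ) : ℂ) ^ (-s')) ^ 2) =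
      fun p : Nat.Primes => ((1 - (p : ℂ) ^ (-s)) * (1 - (p : ℂ) ^ (-s))) *
        ((1 - χ ((p : ℕ) : ZMod D) * (p : ℂ) ^ (-s')) * (1 - χ ((p : ℕ) : ZMod D) * (p : ℂ) ^ (-s'))) := by
    funext p; rw [sq, sq]
  have hval : (riemannZeta s ^ 2 * χ.LFunction s' ^ 2)⁻¹ =
      (riemannZeta s)⁻¹ * (riemannZeta s)⁻¹ * ((L ↗χ s')⁻¹ * (L ↗χ s')⁻¹) := by
    rw [DirichletCharacter.LFunction_eq_LSeries χ hs1, mul_inv, sq, sq, mul_inv, mul_inv]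
  rw [hfun, hval]
  exact h

omit [NeZero D] in
/-- The series of `Section15C.calU1R` (at the instance `inputs15AB`) is the `L`-series of
`n ↦ χ(n)τ₂(n)ϖ₁ⱼ(n)` (at `n = 0` both terms vanish: `τ₂(0) = #∅ = 0`).
[cite: Zhang2022LandauSiegel, §15 Lemma 15.3 p. 87] -/
theorem calU1RSeries_eq_tsum_term (s : ℂ) :
    (∑' n : ℕ, χ (n : ZMod D) * (n.divisors.card : ℂ) * varpi1 c' χ j n / (n : ℂ) ^ s) =
      ∑' n : ℕ, term (fun n => χ (n : ZMod D) * (n.divisors.card : ℂ) * varpi1 c' χ j n) s n := by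
  refine tsum_congr fun n => ?_
  rcases eq_or_ne n 0 with rfl | hn
  · rw [LSeries.term_zero]
    simp
  · rw [LSeries.term_of_ne_zero hn]

/-- **`∏_q 𝔲ᴿ₁ⱼ(q,s) = 𝒰₁ⱼ(s)` (repaired) for `σ > 1`** — given `ϖ₁ⱼ(1) = 1`, multiplicativity of
`ϖ₁ⱼ` and the two size facts (all of which hold for large `D` under (A)):
`HasProd (q ↦ frakU1FactorR c′ χ j q s) (calU1R c′ inputs15AB χ j s)`
(`hasProd_prefR` × `hasProd_chi_tau_varpi1`, local factors `tsum_termG_prime_pow`).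
[cite: Zhang2022LandauSiegel, App. A p. 105] -/
theorem hasProd_frakU1FactorR_calU1R {c C : ℝ} (hv1 : varpi1 c' χ j 1 = 1)
    (hvmul : ∀ m n : ℕ, Nat.Coprime m n → varpi1 c' χ j (m * n) = varpi1 c' χ j m * varpi1 c' χ j n)
    (hM0 : 1 / 2 ≤ ‖calM1 c' χ 1 1 (1 - betaJ c' D j)‖)
    (h35 : ∀ d l : ℕ, 1 ≤ d → 1 ≤ l →
      ‖calM1 c' χ d l (1 - betaJ c' D j)‖ ≤
        C * ∏ q ∈ (d * l).primeFactors, (1 + c * (q : ℝ) ^ (-(9 / 10 : ℝ))))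
    {s : ℂ} (hs : 1 < s.re) :
    HasProd (fun q : Nat.Primes => frakU1FactorR c' χ j (q : ℕ) s)
      (Section15C.calU1R c' inputs15AB χ j s) := by
  have hP := hasProd_prefR c' χ j hs
  have hE := hasProd_chi_tau_varpi1 c' χ j hv1 hvmul hM0 h35 hs
  have hloc : (fun q : Nat.Primes => ∑' e : ℕ,
      term (fun n => χ (n : ZMod D) * (n.divisors.card : ℂ) * varpi1 c' χ j n) s ((q : ℕ) ^ e)) =
      fun q : Nat.Primes => ∑' r : ℕ, χ (((q : ℕ) ^ r : ℕ) : ZMod D) *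
        ((((q : ℕ) ^ r).divisors.card : ℕ) : ℂ) * varpi1 c' χ j ((q : ℕ) ^ r) /
          ((q : ℕ) : ℂ) ^ ((r : ℂ) * s) :=
    funext fun q => tsum_termG_prime_pow c' χ j s q.prop
  rw [hloc] at hE
  have hmul := hP.mul hE
  have hfun : (fun q : Nat.Primes => frakU1FactorR c' χ j (q : ℕ) s) =
      fun q : Nat.Primes => ((1 - ((q : ℕ) : ℂ) ^ (-s)) ^ 2 *
          (1 - χ ((q : ℕ) : ZMod D) * ((q : ℕ) : ℂ) ^ (-(s - betaJ c' D j))) ^ 2) *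
        ∑' r : ℕ, χ (((q : ℕ) ^ r : ℕ) : ZMod D) * ((((q : ℕ) ^ r).divisors.card : ℕ) : ℂ) *
          varpi1 c' χ j ((q : ℕ) ^ r) / ((q : ℕ) : ℂ) ^ ((r : ℂ) * s) := by
    funext q; rfl
  have hval : Section15C.calU1R c' inputs15AB χ j s =
      (riemannZeta s ^ 2 * χ.LFunction (s - betaJ c' D j) ^ 2)⁻¹ *
        ∑' n : ℕ, term (fun n => χ (n : ZMod D) * (n.divisors.card : ℂ) * varpi1 c' χ j n) s n := by
    rw [← calU1RSeries_eq_tsum_term c' χ j s]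
    rfl
  rw [hfun, hval]
  exact hmul

end Assembly

end Literature.NumberTheory.LFunctions.Zhang2022.Typed.Section15C

/-! ## §4. The typed node `Typed.AppendixA2.StepA_u030R` -/

namespace Literature.NumberTheory.LFunctions.Zhang2022.Typed.AppendixA2

open Literature.NumberTheory.LFunctions.Zhang2022
open Literature.NumberTheory.LFunctions.Zhang2022.Skeleton
open Literature.NumberTheory.LFunctions.Zhang2022.Typed.Section15B

/-- **Z22:§A.u030 for the REPAIRED object HOLDS** (`Typed.AppendixA2.StepA_u030R c′`; App. A p. 105
tex L5174, at the repaired normaliser of GAP row G-L4t3-1): for all large `D`, under (A), `1 ≤ j ≤ 3`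
and `σ > 1`, `𝒰₁ⱼ(s) = ∏'_q 𝔲ᴿ₁ⱼ(q,s)` — by `Section15C.hasProd_frakU1FactorR_calU1R`, whose inputs
hold eventually: `ϖ₁ⱼ` multiplicative with `ϖ₁ⱼ(1) = 1` (`inline15_varpiMult_holds`),
`‖𝓜₁(1,1;1−βⱼ)‖ ≥ 1/2` (`norm_calM1_one_one_betaJ_ge`), u035 (`step15_u035_holds`) at `s = 1 − βⱼ`
(`Re = 1 > 9/10`). [cite: Zhang2022LandauSiegel, App. A p. 105] -/
theorem stepA_u030R_holds (c' : ℝ) : StepA_u030R c' := by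
  obtain ⟨c, C, h35⟩ := step15_u035_holds c'
  refine ((h35.and (inline15_varpiMult_holds c')).and (norm_calM1_one_one_betaJ_ge c')).mono
    fun D _ χ _ _ hS hA j hj s hs => ?_
  obtain ⟨⟨h35D, hmultD⟩, hM0D⟩ := hS
  obtain ⟨hv1, hvmul⟩ := hmultD hA j hj
  obtain ⟨-, hre1, hM0⟩ := hM0D hA j hj
  have h35' : ∀ d l : ℕ, 1 ≤ d → 1 ≤ l →
      ‖calM1 c' χ d l (1 - betaJ c' D j)‖ ≤
        C * ∏ q ∈ (d * l).primeFactors, (1 + c * (q : ℝ) ^ (-(9 / 10 : ℝ))) :=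
    fun d l hd hl => h35D hA d l hd hl _ (by rw [hre1]; norm_num)
  exact (Section15C.hasProd_frakU1FactorR_calU1R c' χ j hv1 hvmul hM0 h35' hs).tprod_eq.symm

variable (c' : ℝ) in
/-- `StepA_u030R` — `_holds` alias of `stepA_u030R_holds` above under the fact's exact name, stated under the
prover's own binders as section variables (appended 2026-08-28, D-0026 bookkeeping: the proof term is the
existing theorem of this file; no statement, definition or attribute is edited; no new named fact; the
ledger's debt table listed the fact unproved). [cite: Zhang2022LandauSiegel, App. A p. 105] -/
theorem _root_.Literature.NumberTheory.LFunctions.Zhang2022.Typed.AppendixA2.StepA_u030R_holds :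
    _root_.Literature.NumberTheory.LFunctions.Zhang2022.Typed.AppendixA2.StepA_u030R c' :=
  _root_.Literature.NumberTheory.LFunctions.Zhang2022.Typed.AppendixA2.stepA_u030R_holds (c' := c')

end Literature.NumberTheory.LFunctions.Zhang2022.Typed.AppendixA2

end
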